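import Literature.Probability.Percolation.StaircaseJunctions
import HarnessLib

/-!
# Cells of the staircase corridors: keys on the lowest ring, read on every ring

Topic: Probability / Percolation; family `crit-perc`. A brick of the GENERIC landing layer of
Nolin's arm-separation theorem (Nolin 2008, Thm. 11, §4.4 [arXiv 0711.4948: Thm. 10, p. 12,
Fig. 6: "RSW in corridors"]), towards
`Literature.Probability.Percolation.Nolin2008_prop17_quasiMult` (`FiveArmExponentFacts.lean`).

The lateral positions of the corridors are CELLS of the lowest ring (radius `r₀ = n₀ s`): a side
`i < 6` and a rank `ρ < n₀` (the `ρ`-th piece of the side, counterclockwise), encoded by the KEY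
`i n₀ + ρ ∈ [0, 6 n₀)`; the schedule (`StaircaseSchedule.lean`, `StaircaseTable.lean`) moves
LIFTED integer keys, read modulo `C = 6 n₀`. Going up to the ring with `q` more chunks per side
(radius `r₀ + q s`) along the level connectors, the cell keeps its side and its rank becomes
`Staircase.upIdx q i ρ` (`StaircaseJunctions.lean`); its ring position there is
`Staircase.cellPos n₀ q i ρ = extPos (n₀ + q) i (upIdx q i ρ)`. This file records the
bookkeeping: ranges, the key order is the ring order on every ring (`extPos_lt_extPos`,
`cellPos_lt_cellPos`), rank gaps double as ring-position gaps within a side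
(`cellPos_add_le`), and the coherence of two climbs (`upIdx_add`).

## Main definitions

* `Staircase.keySide n₀ x`, `Staircase.keyRank n₀ x` — side and rank of the lifted key `x : ℤ`;
* `Staircase.cellPos n₀ q i ρ` — ring position, `q` levels of chunks up.

## Main results

* `Staircase.keySide_lt`, `Staircase.keyRank_lt`, `Staircase.key_eq`;
* `Staircase.extPos_lt_extPos`, `Staircase.cellPos_lt_cellPos`, `Staircase.cellPos_add_le`,
  `Staircase.cellPos_lt`, `Staircase.upIdx_add`, `Staircase.upIdx_lt`.

## References

* P. Nolin, *Near-critical percolation in two dimensions*, Electron. J. Probab. 13 (2008), §4.4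
  (arXiv 0711.4948: proof of Thm. 10, p. 12, Fig. 6). [Nolin2008]
-/

namespace Literature.Probability.Percolation

namespace Staircase

/-! ### Keys -/

/-- The side of the lifted key `x`: `⌊(x mod 6n₀) / n₀⌋`. [folklore] -/
def keySide (n₀ : ℕ) (x : ℤ) : ℕ := (x % (6 * n₀ : ℕ)).toNat / n₀

/-- The rank of the lifted key `x` within its side: `(x mod 6n₀) mod n₀`. [folklore] -/
def keyRank (n₀ : ℕ) (x : ℤ) : ℕ := (x % (6 * n₀ : ℕ)).toNat % n₀

variable {n₀ : ℕ}

/-- The reduced key lies in `[0, 6n₀)`. [folklore] -/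
theorem key_toNat_lt (hn : 0 < n₀) (x : ℤ) : (x % (6 * n₀ : ℕ)).toNat < 6 * n₀ := by
  have h0 : (0 : ℤ) < (6 * n₀ : ℕ) := by exact_mod_cast (show 0 < 6 * n₀ by omega)
  have h1 := Int.emod_nonneg x h0.ne'
  have h2 := Int.emod_lt_of_pos x h0
  omega

/-- The side of a key is `< 6`. [folklore] -/
theorem keySide_lt (hn : 0 < n₀) (x : ℤ) : keySide n₀ x < 6 := by
  unfold keySide
  have h := key_toNat_lt hn x
  exact Nat.div_lt_of_lt_mul (by omega)

/-- The rank of a key is `< n₀`. [folklore] -/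
theorem keyRank_lt (hn : 0 < n₀) (x : ℤ) : keyRank n₀ x < n₀ := Nat.mod_lt _ hn

/-- The reduced key is `side · n₀ + rank`. [folklore] -/
theorem key_eq (x : ℤ) : (x % (6 * n₀ : ℕ)).toNat = keySide n₀ x * n₀ + keyRank n₀ x := by
  unfold keySide keyRank
  exact (Nat.div_add_mod' _ _).symm

/-! ### Ring positions of cells -/

/-- **The ring position of the cell `(i, ρ)` of the lowest ring, `q` levels of chunks up.** [cite: Nolin2008, §4.4 (arXiv 0711.4948: proof of Thm. 10, p. 12, Fig. 6)] -/
def cellPos (n₀ q i ρ : ℕ) : ℕ := extPos (n₀ + q) i (upIdx q i ρ)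

/-- Two climbs compose. [folklore] -/
theorem upIdx_add (q q' i ρ : ℕ) : upIdx (q + q') i ρ = upIdx q' i (upIdx q i ρ) := by
  unfold upIdx; split_ifs <;> omega

/-- The rank up the levels stays in range. [folklore] -/
theorem upIdx_lt {q i ρ : ℕ} (hρ : ρ < n₀) : upIdx q i ρ < n₀ + q := by
  unfold upIdx; split_ifs <;> omega

/-- **The key order is the ring order**: on a ring with `n` chunks per side, the piece of rank
`ρ` of the side `i` comes before the piece of rank `ρ'` of the side `i'` whenever
`(i, ρ) < (i', ρ')` lexicographically (`i' < 6`, `ρ < n`). [folklore] -/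
theorem extPos_lt_extPos {n i ρ i' ρ' : ℕ} (hi' : i' < 6) (hρ : ρ < n)
    (h : i < i' ∨ (i = i' ∧ ρ < ρ')) : extPos n i ρ < extPos n i' ρ' := by
  unfold extPos
  rcases h with h | ⟨rfl, h⟩
  · have key : ∀ a < 6, ∀ b < 6, a < b → blockOff n a + 2 * (n - 1) < blockOff n b := by
      intro a ha b hb hab
      interval_cases b <;> interval_cases a <;> simp only [blockOff] <;> omega
    have := key i (by omega) i' hi' h
    omega
  · omega

/-- **Cells in key order are in ring order on every level** (`(i, ρ) < (i', ρ')`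
lexicographically, `i' < 6`, `ρ, ρ' < n₀`). [folklore] -/
theorem cellPos_lt_cellPos {q i ρ i' ρ' : ℕ} (hi' : i' < 6) (hρ : ρ < n₀) (hρ' : ρ' < n₀)
    (h : i < i' ∨ (i = i' ∧ ρ < ρ')) : cellPos n₀ q i ρ < cellPos n₀ q i' ρ' := by
  unfold cellPos
  refine extPos_lt_extPos hi' (upIdx_lt hρ) ?_
  rcases h with h | ⟨rfl, h⟩
  · exact Or.inl h
  · right; refine ⟨rfl, ?_⟩
    have := hρ'
    unfold upIdx; split_ifs <;> omega

/-- **Rank gaps double as ring gaps within a side**: `cellPos (i, ρ) + 2d ≤ cellPos (i, ρ + d)`. [folklore] -/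
theorem cellPos_add_le (q i ρ d : ℕ) : cellPos n₀ q i ρ + 2 * d ≤ cellPos n₀ q i (ρ + d) := by
  unfold cellPos extPos upIdx
  split_ifs <;> omega

/-- The ring position of a cell is in range (`i < 6`, `ρ < n₀`). [folklore] -/
theorem cellPos_lt {q i ρ : ℕ} (hi : i < 6) (hρ : ρ < n₀) : cellPos n₀ q i ρ < 12 * (n₀ + q) - 4 :=
  extPos_lt (by omega) hi (upIdx_lt hρ)

/-- **The cell one more level up**: climbing `q'` further levels of chunks from the level `q`
is climbing `q + q'` from the lowest ring (the coherence clause `CorridorData.WF.hup`). [folklore] -/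
theorem cellPos_add (q q' i ρ : ℕ) : cellPos n₀ (q + q') i ρ = extPos (n₀ + q + q') i (upIdx q' i (upIdx q i ρ)) := by
  unfold cellPos; rw [upIdx_add, Nat.add_assoc]

end Staircase

end Literature.Probability.Percolation
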